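import Summits.BirchSwinnertonDyer.BirchSwinnertonDyer.Theorems.ThetaPartnerAtTwoSignedKatoUpToAtTwoIwasawaInvolutionTwist
import Summits.BirchSwinnertonDyer.BirchSwinnertonDyer.Theorems.ThetaPartnerAtTwoSignedKatoUpToAtTwoSemilinearImage
import Summits.BirchSwinnertonDyer.BirchSwinnertonDyer.Theorems.ThetaPartnerAtTwoSignedKatoUpToAtTwoInvolFunctionalEquation
import Literature.NumberTheory.EllipticCurves.IwasawaAlgebraInvolution
import HarnessLib

/-!
# Route `ThetaPartnerAtTwo` (TP2), crux K3 `SignedKatoDivisibilityUpToAtTwo` (item stmt-BirchSwinnertonDyer-20308),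
# line `colemanrat` v5 — the involution algebra IN THE CURRENCY OF THE REGISTERED v5 STUBS
# (`IwasawaAlgebra.invol 2`, `PrimeSpectrum.comap (IwasawaAlgebra.invol 2).toRingHom 𝔭`, `IsPollackPair`, `kobayashiL 1`)

Width seat `bsd-wall-tp2-p2x-w3` g3 (cell `bsd-wall`). HONEST FRAMING: THEOREMS ONLY — no definition, no named fact, no instance,
no `sorry`; route-independent (no `Theses` import); closes no item; BSD is NOT proved by any of this.

## Why this file

`…SemilinearTransport`, `…SemilinearImage` and `…IwasawaInvolutionTwist` (this seat) are stated for an ABSTRACT involution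
`ι : Λ ≃+* Λ` with `ι f = f.subst invOnePlusSubOne` (the tree's `Literature.Barriers.BirchSwinnertonDyer.invOnePlusSubOne`).
Meanwhile the width seat w2 landed the NAMED involution `Literature.NumberTheory.EllipticCurves.IwasawaAlgebra.invol p`
(`…IwasawaAlgebraInvolution`, substitution of `IwasawaAlgebra.invSubOne p := PowerSeries.invOfUnit (1+T) 1 − 1`), and the K3
lead registered skeleton `colemanrat` v5 whose stubs (R2^ι) `stub_localRobustPackageTwoInv`, (K2^ι) `stub_katoBoundTwoInv` and
CHAIN^ι `stub_involChainTwo` are typed with `IwasawaAlgebra.invol 2` and `PrimeSpectrum.comap (IwasawaAlgebra.invol 2).toRingHom`.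
The two agree (`Invol.invSubOne_eq_invOnePlusSubOne`, w2 g3's `…InvolFunctionalEquation`); this file supplies the hypothesis `hι`
for `ι := IwasawaAlgebra.involEquiv p`, and re-issues the deliverables CHAIN^ι consumes in exactly the v5 spelling, including the
functional-equation step at `p = 2` as a length identity (`Invol.exists_isUnit_invol_kobayashiL_one_eq_mul` + transport).

## What is proved

* §1 (on top of w2 g3's `…InvolFunctionalEquation`: `Invol.invSubOne_eq_invOnePlusSubOne`, `Invol.invol_eq_subst_invOnePlusSubOne`)
  **`involEquiv_eq_subst`** (the `hι` of this seat's files for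
  `ι = IwasawaAlgebra.involEquiv p`), `ideal_comap_invol_toRingHom`, **`primeSpectrum_comap_invol_eq`**
  (`PrimeSpectrum.comap (invol p).toRingHom 𝔭 = ⟨𝔭.asIdeal.comap (involEquiv p), _⟩`), `C_not_mem_comap_invol_iff`,
  `height_comap_invol`.
* §2 v5 currency, any `p`: **`lengthAt_quotient_ker_eq_lengthAt_range_invol`** / `lengthAt_range_le_invol` (for an additive
  `j` with `j (g • y) = IwasawaAlgebra.invol p g • j y`: `ℓ_𝔭(im j) = ℓ_{comap ι 𝔭}(P ⧸ ker j)`, `≤ ℓ_{comap ι 𝔭}(P ⧸ K')` for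
  `K' ⊆ ker j`), **`exists_twist_signedSelmerDualData_invol`**, **`exists_twist_fineSelmerDualData_invol`**,
  `lengthAt_quotient_span_comap_invol_eq_of_fe`.
* §3 `p = 2`: **`lengthAt_quotient_kobayashiL_comap_invol_eq`** — for the newform `f` of a globally minimal `W` with
  `GoodSS W 2`, `a₂ = 0` and a Pollack pair `(L⁺, L⁻)`: `ℓ_{comap ι 𝔭}(Λ/(L_Ko)) = ℓ_𝔭(Λ/(L_Ko))`, `L_Ko = kobayashiL 1 L⁺ L⁻`
  (the «`ℓ_{ι𝔭}(Λ/L♭) = ℓ_𝔭(Λ/L♭)`» step of CHAIN^ι as a LENGTH identity, from w2 g3's unit form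
  `Invol.exists_isUnit_invol_kobayashiL_one_eq_mul` of the in-tree functional equation).

References: [GreenbergLNM1716, §1]; [MazurTateTeitelbaum1986Invent, §I.17]; [Sprung2017, Cor. 4.14]; [Kobayashi2003, Def. 1.1].
-/

set_option autoImplicit false
-- the Theorems namespace of this sub repeats the summit name by design (D-0017 nested layout)
set_option linter.dupNamespace false

noncomputable section

open scoped Classical MatrixGroups ModularForm

namespace Summit.BirchSwinnertonDyer.BirchSwinnertonDyer.Theorems

namespace SignedKatoOffTwo.IwasawaInvolution

open PowerSeries CongruenceSubgroup Literature.NumberTheory.EllipticCurves Literature.NumberTheory.EllipticCurves.Module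
  Literature.Barriers.BirchSwinnertonDyer Literature.NumberTheory.EllipticCurves.ModularForms
  Literature.NumberTheory.EllipticCurves.Rank1Residual Summit.BirchSwinnertonDyer.Rank1Residual.Supersingular

universe u

/-! ## §1 `IwasawaAlgebra.invol p` is substitution of `invOnePlusSubOne` -/

section Named

variable (p : ℕ) [Fact p.Prime]

/-- **The hypothesis `hι` of this seat's abstract-`ι` files for the named involution**:
`(IwasawaAlgebra.involEquiv p : Λ ≃+* Λ) f = f.subst invOnePlusSubOne`. [folklore] -/
theorem involEquiv_eq_subst (f : IwasawaAlgebra p) :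
    (IwasawaAlgebra.involEquiv p : IwasawaAlgebra p ≃+* IwasawaAlgebra p) f = subst (invOnePlusSubOne : ℤ_[p]⟦X⟧) f := by
  rw [← Invol.invol_eq_subst_invOnePlusSubOne]
  rfl

/-- `(IwasawaAlgebra.involEquiv p : Λ ≃+* Λ) f = IwasawaAlgebra.invol p f` (unfolding the coercion). [folklore] -/
theorem involEquiv_ringEquiv_apply (f : IwasawaAlgebra p) :
    (IwasawaAlgebra.involEquiv p : IwasawaAlgebra p ≃+* IwasawaAlgebra p) f = IwasawaAlgebra.invol p f := rfl

/-- `Ideal.comap` along `invol p` (as a ring hom) and along `involEquiv p` (as a ring equivalence) agree. [folklore] -/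
theorem ideal_comap_invol_toRingHom (I : Ideal (IwasawaAlgebra p)) :
    I.comap (IwasawaAlgebra.invol p).toRingHom =
      I.comap (IwasawaAlgebra.involEquiv p : IwasawaAlgebra p ≃+* IwasawaAlgebra p) := by
  ext f
  simp only [Ideal.mem_comap]
  rfl

/-- **The v5 prime `PrimeSpectrum.comap (invol p).toRingHom 𝔭` is the point `⟨𝔭.asIdeal.comap (involEquiv p), _⟩` of this
seat's files.** [folklore] -/
theorem primeSpectrum_comap_invol_eq (𝔭 : PrimeSpectrum (IwasawaAlgebra p)) :
    PrimeSpectrum.comap (IwasawaAlgebra.invol p).toRingHom 𝔭 =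
      ⟨𝔭.asIdeal.comap (IwasawaAlgebra.involEquiv p : IwasawaAlgebra p ≃+* IwasawaAlgebra p), inferInstance⟩ :=
  PrimeSpectrum.ext (by rw [PrimeSpectrum.comap_asIdeal, ideal_comap_invol_toRingHom])

/-- `2 ∉ ι𝔭 ↔ 2 ∉ 𝔭` (indeed `C c` for any constant `c`), v5 spelling. [folklore] -/
theorem C_mem_comap_invol_iff (c : ℤ_[p]) (𝔭 : PrimeSpectrum (IwasawaAlgebra p)) :
    C c ∈ (PrimeSpectrum.comap (IwasawaAlgebra.invol p).toRingHom 𝔭).asIdeal ↔ C c ∈ 𝔭.asIdeal := by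
  rw [PrimeSpectrum.comap_asIdeal, Ideal.mem_comap]
  change IwasawaAlgebra.invol p (C c) ∈ 𝔭.asIdeal ↔ _
  rw [IwasawaAlgebra.invol_C]

/-- `ι𝔭` has the same height as `𝔭`, v5 spelling (Mathlib `RingEquiv.height_comap`). [folklore] -/
theorem height_comap_invol (𝔭 : PrimeSpectrum (IwasawaAlgebra p)) :
    (PrimeSpectrum.comap (IwasawaAlgebra.invol p).toRingHom 𝔭).asIdeal.height = 𝔭.asIdeal.height := by
  rw [primeSpectrum_comap_invol_eq]
  exact RingEquiv.height_comap _ _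

/-- `ι(ι𝔭) = 𝔭`, v5 spelling. [folklore] -/
theorem comap_invol_comap_invol (𝔭 : PrimeSpectrum (IwasawaAlgebra p)) :
    PrimeSpectrum.comap (IwasawaAlgebra.invol p).toRingHom
      (PrimeSpectrum.comap (IwasawaAlgebra.invol p).toRingHom 𝔭) = 𝔭 := by
  apply PrimeSpectrum.ext
  rw [PrimeSpectrum.comap_asIdeal, PrimeSpectrum.comap_asIdeal, ideal_comap_invol_toRingHom,
    ideal_comap_invol_toRingHom]
  exact comap_comap_invol _ (involEquiv_eq_subst p) 𝔭.asIdeal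

end Named


/-! ## §2 The deliverables in v5 currency (any prime `p`) -/

section Currency

variable {p : ℕ} [Fact p.Prime]

/-- **`ℓ_𝔭(im j) = ℓ_{ι𝔭}(P ⧸ ker j)` for an additive `j` with `j (g • y) = IwasawaAlgebra.invol p g • j y`** (v5's (R2^ι)
Poitou–Tate map), for ANY submodules `K`, `L` with carriers `ker j`, `im j`; `ι𝔭 = PrimeSpectrum.comap (invol p) 𝔭`.
[folklore] -/
theorem lengthAt_range_eq_lengthAt_quotient_ker_invol {P X : Type*} [AddCommGroup P] [Module (IwasawaAlgebra p) P]
    [AddCommGroup X] [Module (IwasawaAlgebra p) X] (j : P →+ X)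
    (hj : ∀ (g : IwasawaAlgebra p) (y : P), j (g • y) = IwasawaAlgebra.invol p g • j y)
    (K : Submodule (IwasawaAlgebra p) P) (hK : ∀ y, y ∈ K ↔ j y = 0)
    (L : Submodule (IwasawaAlgebra p) X) (hL : ∀ x, x ∈ L ↔ x ∈ Set.range j)
    (𝔭 : PrimeSpectrum (IwasawaAlgebra p)) :
    lengthAt (IwasawaAlgebra p) L 𝔭 =
      lengthAt (IwasawaAlgebra p) (P ⧸ K) (PrimeSpectrum.comap (IwasawaAlgebra.invol p).toRingHom 𝔭) := by
  rw [primeSpectrum_comap_invol_eq]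
  exact (SemilinearTransport.lengthAt_quotient_ker_eq_lengthAt_range
    (σ := (IwasawaAlgebra.involEquiv p : IwasawaAlgebra p ≃+* IwasawaAlgebra p)) (fun g y ↦ hj g y) K hK L hL rfl).symm

/-- **`ℓ_𝔭(im j) ≤ ℓ_{ι𝔭}(P ⧸ K')` for any submodule `K'` killed by `j`** (e.g. `K' = 2^m·im col` under the reciprocity
`2^m · j ∘ col = 0` of (R2^ι)); `j` additive with `j (g • y) = IwasawaAlgebra.invol p g • j y`. [folklore] -/
theorem lengthAt_range_le_lengthAt_quotient_invol {P X : Type*} [AddCommGroup P] [Module (IwasawaAlgebra p) P]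
    [AddCommGroup X] [Module (IwasawaAlgebra p) X] (j : P →+ X)
    (hj : ∀ (g : IwasawaAlgebra p) (y : P), j (g • y) = IwasawaAlgebra.invol p g • j y)
    (K' : Submodule (IwasawaAlgebra p) P) (hK' : ∀ y ∈ K', j y = 0)
    (L : Submodule (IwasawaAlgebra p) X) (hL : ∀ x, x ∈ L ↔ x ∈ Set.range j)
    (𝔭 : PrimeSpectrum (IwasawaAlgebra p)) :
    lengthAt (IwasawaAlgebra p) L 𝔭 ≤
      lengthAt (IwasawaAlgebra p) (P ⧸ K') (PrimeSpectrum.comap (IwasawaAlgebra.invol p).toRingHom 𝔭) := by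
  obtain ⟨K, hK⟩ := SemilinearTransport.exists_ker_submodule
    (IwasawaAlgebra.involEquiv p : IwasawaAlgebra p ≃+* IwasawaAlgebra p) j (fun g y ↦ hj g y)
  rw [lengthAt_range_eq_lengthAt_quotient_ker_invol j hj K hK L hL 𝔭]
  -- `K' ≤ K`, so `P ⧸ K` is a quotient of `P ⧸ K'`
  have hle : K' ≤ K := fun y hy ↦ (hK y).2 (hK' y hy)
  exact lengthAt_le_of_surjective (Submodule.factor hle) (Submodule.factor_surjective hle) _

/-- `ℓ_𝔭(im j) ≤ ℓ_{ι𝔭}(P)` (`j` additive, `invol`-semilinear). [folklore] -/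
theorem lengthAt_range_le_invol {P X : Type*} [AddCommGroup P] [Module (IwasawaAlgebra p) P]
    [AddCommGroup X] [Module (IwasawaAlgebra p) X] (j : P →+ X)
    (hj : ∀ (g : IwasawaAlgebra p) (y : P), j (g • y) = IwasawaAlgebra.invol p g • j y)
    (L : Submodule (IwasawaAlgebra p) X) (hL : ∀ x, x ∈ L ↔ x ∈ Set.range j)
    (𝔭 : PrimeSpectrum (IwasawaAlgebra p)) :
    lengthAt (IwasawaAlgebra p) L 𝔭 ≤
      lengthAt (IwasawaAlgebra p) P (PrimeSpectrum.comap (IwasawaAlgebra.invol p).toRingHom 𝔭) := by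
  rw [primeSpectrum_comap_invol_eq]
  exact SemilinearTransport.lengthAt_range_le
    (σ := (IwasawaAlgebra.involEquiv p : IwasawaAlgebra p ≃+* IwasawaAlgebra p)) (fun g y ↦ hj g y) L hL rfl

/-- **`ℓ_{ι𝔭}(Λ/(L)) = ℓ_𝔭(Λ/(L))` under a functional equation `L(T^ι) = v L`, `v ∈ Λˣ`**, v5 spelling. [folklore] -/
theorem lengthAt_quotient_span_comap_invol_eq_of_fe {L v : IwasawaAlgebra p} (hv : IsUnit v)
    (hFE : subst (invOnePlusSubOne : ℤ_[p]⟦X⟧) L = v * L) (𝔭 : PrimeSpectrum (IwasawaAlgebra p)) :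
    lengthAt (IwasawaAlgebra p) (IwasawaAlgebra p ⧸ Ideal.span {L})
        (PrimeSpectrum.comap (IwasawaAlgebra.invol p).toRingHom 𝔭) =
      lengthAt (IwasawaAlgebra p) (IwasawaAlgebra p ⧸ Ideal.span {L}) 𝔭 := by
  rw [primeSpectrum_comap_invol_eq]
  exact lengthAt_quotient_span_comap_eq_of_fe _ (involEquiv_eq_subst p) hv hFE 𝔭

variable {K : Type u} [Field K] [NumberField K] {W : WeierstrassCurve K} {κ : ZpExtension K p}
  {γ δ : Field.absoluteGaloisGroup K} {ε : ℤˣ}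

open Kobayashi2003 in
/-- **The `γ ↦ γ⁻¹` twist of a signed dual datum is its `IwasawaAlgebra.invol`-twist** (v5 spelling of
`exists_twist_signedSelmerDualData`). [cite: Kobayashi2003, Def. 1.1 and Thm. 1.2 (the object only)] -/
theorem exists_twist_signedSelmerDualData_invol (hγδ : γ * δ = 1) (D : SignedSelmerDualData W κ γ ε) :
    ∃ (D' : SignedSelmerDualData W κ δ ε) (e : D.X ≃+ D'.X),
      (∀ (f : IwasawaAlgebra p) (x : D.X), e (f • x) = IwasawaAlgebra.invol p f • e x) ∧
      (∀ x : D.X, D'.toDual (e x) = D.toDual x) ∧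
      (Module.IsTorsion (IwasawaAlgebra p) D.X ↔ Module.IsTorsion (IwasawaAlgebra p) D'.X) ∧
      D'.charIdeal = D.charIdeal.map (IwasawaAlgebra.invol p) ∧
      ∀ 𝔓 : PrimeSpectrum (IwasawaAlgebra p),
        lengthAt (IwasawaAlgebra p) D.X (PrimeSpectrum.comap (IwasawaAlgebra.invol p).toRingHom 𝔓) =
          lengthAt (IwasawaAlgebra p) D'.X 𝔓 := by
  obtain ⟨D', e, he, hdual, htors, hchar, hlen⟩ :=
    exists_twist_signedSelmerDualData_invariants _ (involEquiv_eq_subst p) hγδ D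
  refine ⟨D', e, fun f x ↦ he f x, hdual, htors, ?_, fun 𝔓 ↦ ?_⟩
  · rw [hchar]
    rfl
  · rw [primeSpectrum_comap_invol_eq]
    exact hlen 𝔓

/-- **The `γ ↦ γ⁻¹` twist of a fine dual datum is its `IwasawaAlgebra.invol`-twist** (v5 spelling; K2's `Y`).
[cite: Kato2004Asterisque, Conj. 12.10 (p. 224)] -/
theorem exists_twist_fineSelmerDualData_invol (hγδ : γ * δ = 1) (Y : W.FineSelmerDualData κ γ) :
    ∃ (Y' : W.FineSelmerDualData κ δ) (e : Y.X ≃+ Y'.X),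
      (∀ (f : IwasawaAlgebra p) (x : Y.X), e (f • x) = IwasawaAlgebra.invol p f • e x) ∧
      (∀ x : Y.X, Y'.toDual (e x) = Y.toDual x) ∧
      (Module.IsTorsion (IwasawaAlgebra p) Y.X ↔ Module.IsTorsion (IwasawaAlgebra p) Y'.X) ∧
      Y'.charIdeal = Y.charIdeal.map (IwasawaAlgebra.invol p) ∧
      ∀ 𝔓 : PrimeSpectrum (IwasawaAlgebra p),
        lengthAt (IwasawaAlgebra p) Y.X (PrimeSpectrum.comap (IwasawaAlgebra.invol p).toRingHom 𝔓) =
          lengthAt (IwasawaAlgebra p) Y'.X 𝔓 := by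
  obtain ⟨Y', e, he, hdual, htors, hchar, hlen⟩ :=
    exists_twist_fineSelmerDualData_invariants _ (involEquiv_eq_subst p) hγδ Y
  refine ⟨Y', e, fun f x ↦ he f x, hdual, htors, ?_, fun 𝔓 ↦ ?_⟩
  · rw [hchar]
    rfl
  · rw [primeSpectrum_comap_invol_eq]
    exact hlen 𝔓

end Currency

/-! ## §3 `p = 2`: the functional-equation step of CHAIN^ι from a POLLACK pair (K3's hypothesis) -/

section Two

variable {W : WeierstrassCurve ℚ} [W.IsElliptic] [W.IsGloballyMinimal] [NeZero (W.conductorNorm ℤ)]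
  {f : CuspForm (Gamma0 (W.conductorNorm ℤ)) 2}

/-- **`ℓ_{ι𝔭}(Λ/(L_Ko)) = ℓ_𝔭(Λ/(L_Ko))` at `2`** — the «`ℓ_{ι𝔭}(Λ/L♭) = ℓ_𝔭(Λ/ι L♭) = ℓ_𝔭(Λ/L♭)`» step of CHAIN^ι, v5
spelling, functional equation IN TREE. [cite: Sprung2017, Cor. 4.14] [cite: MazurTateTeitelbaum1986Invent, §I.17] -/
theorem lengthAt_quotient_kobayashiL_comap_invol_eq (hf : IsNewformOf W f) (hss : GoodSS W 2)
    (ha0 : W.frobeniusTrace 2 = 0) {Lplus Lminus : IwasawaAlgebra 2} (hPP : IsPollackPair f 2 Lplus Lminus)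
    (𝔭 : PrimeSpectrum (IwasawaAlgebra 2)) :
    lengthAt (IwasawaAlgebra 2) (IwasawaAlgebra 2 ⧸ Ideal.span {kobayashiL 1 Lplus Lminus})
        (PrimeSpectrum.comap (IwasawaAlgebra.invol 2).toRingHom 𝔭) =
      lengthAt (IwasawaAlgebra 2) (IwasawaAlgebra 2 ⧸ Ideal.span {kobayashiL 1 Lplus Lminus}) 𝔭 := by
  obtain ⟨v, hv, hFE⟩ := Invol.exists_isUnit_invol_kobayashiL_one_eq_mul hf hss ha0 hPP
  rw [Invol.invol_eq_subst_invOnePlusSubOne] at hFE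
  exact lengthAt_quotient_span_comap_invol_eq_of_fe hv hFE 𝔭

/-- The same at the prime `ι𝔭` in place of `𝔭` (`ι` is an involution): `ℓ_𝔭(Λ/(L_Ko)) = ℓ_{ι𝔭}(Λ/(L_Ko))` read the
other way, for chains that START at `ι𝔭`. [folklore] -/
theorem lengthAt_quotient_kobayashiL_eq_comap_invol (hf : IsNewformOf W f) (hss : GoodSS W 2)
    (ha0 : W.frobeniusTrace 2 = 0) {Lplus Lminus : IwasawaAlgebra 2} (hPP : IsPollackPair f 2 Lplus Lminus)
    (𝔭 : PrimeSpectrum (IwasawaAlgebra 2)) :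
    lengthAt (IwasawaAlgebra 2) (IwasawaAlgebra 2 ⧸ Ideal.span {kobayashiL 1 Lplus Lminus}) 𝔭 =
      lengthAt (IwasawaAlgebra 2) (IwasawaAlgebra 2 ⧸ Ideal.span {kobayashiL 1 Lplus Lminus})
        (PrimeSpectrum.comap (IwasawaAlgebra.invol 2).toRingHom 𝔭) :=
  (lengthAt_quotient_kobayashiL_comap_invol_eq hf hss ha0 hPP 𝔭).symm

end Two

end SignedKatoOffTwo.IwasawaInvolution

end Summit.BirchSwinnertonDyer.BirchSwinnertonDyer.Theorems

end
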